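import Summits.Ventures.DiscreteObjects.Runbook.FanoPlaneSanity
import Summits.Ventures.DiscreteObjects.PP12.FixedPointCongruences
import HarnessLib

/-!
# Runbook sanity: a non-identity collineation of prime order on the Fano plane

Framing (verbatim for the cell): lottery ticket; floor = certified bounds/negative ranges.

REVIEW-RUNBOOK card (2)(b) row for cell `pub-namedobj`, target M: `PP12.Collineation.prime_order_atlas_order12` quantifies over a projective
plane `[ProjectivePlane P L]` with `order P L = 12`, a collineation `σ : PP12.Collineation P L` with `σ.onPoints ≠ 1` and a prime `p` with
`σ.onPoints ^ p = 1`.  On the Fano plane of `FanoPlaneSanity` (order 2) the translation `p ↦ p + 1`, `l ↦ l + 1` is such a collineation with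
`p = 7` (`collineation_hypotheses_satisfiable_order2`): every hypothesis except `order P L = 12` is jointly satisfiable, and the structure
`PP12.Collineation` is inhabited beyond the identity.  WHAT CANNOT BE WITNESSED: the order-12 telescope — existence of a projective plane of
order 12 is the open problem the census attacks.  Ops-runbook seat; nothing here is a claim about the census rows.
-/

namespace Summit.Ventures.DiscreteObjects.Runbook

open Configuration
open Summit.Ventures.DiscreteObjects.PP12 (Collineation)

/-- the translation `i ↦ i + 1` on Fano points, as a permutation (inverse `i ↦ i − 1`). -/
def fanoShiftPoints : Equiv.Perm FanoPoint where
  toFun p := ⟨p.val + 1⟩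
  invFun p := ⟨p.val - 1⟩
  left_inv p := by cases p; simp
  right_inv p := by cases p; simp

/-- the translation `j ↦ j + 1` on Fano lines. -/
def fanoShiftLines : Equiv.Perm FanoLine where
  toFun l := ⟨l.val + 1⟩
  invFun l := ⟨l.val - 1⟩
  left_inv l := by cases l; simp
  right_inv l := by cases l; simp

/-- incidence `i − j ∈ {0,1,3}` is translation invariant (checked over all 49 pairs). [folklore] -/
theorem fanoShift_mem_iff : ∀ (p : FanoPoint) (l : FanoLine), fanoShiftPoints p ∈ fanoShiftLines l ↔ p ∈ l := by
  decide

/-- **The translation collineation of the Fano plane** (`p ↦ p + 1`, `l ↦ l + 1`), in the cell's `PP12.Collineation` vocabulary. [folklore] -/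
def fanoShift : Collineation FanoPoint FanoLine where
  onPoints := fanoShiftPoints
  onLines := fanoShiftLines
  mem_iff := fanoShift_mem_iff

/-- The translation collineation is not the identity on points … [folklore] -/
theorem fanoShift_onPoints_ne_one : fanoShift.onPoints ≠ 1 := by
  intro h
  have h0 := congrArg (fun f : Equiv.Perm FanoPoint => (f ⟨0⟩).val) h
  revert h0
  decide

/-- … and has the prime order 7: `σ⁷ = 1` on points. [folklore] -/
theorem fanoShift_onPoints_pow_seven : fanoShift.onPoints ^ 7 = 1 := by
  decide

/-- Joint satisfiability of the hypotheses of `PP12.Collineation.prime_order_atlas_order12` EXCEPT `order P L = 12`: a finite projective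
plane (order 2) with a collineation `σ ≠ 1` on points and `σ ^ p = 1` for the prime `p = 7`.  (At order 12 the atlas excludes 7 —
`NoOrderSeven` — with no contradiction: the conclusion depends on the order.  The order-12 telescope itself cannot be witnessed:
existence of a projective plane of order 12 is the open problem.) [folklore] -/
theorem collineation_hypotheses_satisfiable_order2 :
    ∃ σ : Collineation FanoPoint FanoLine, σ.onPoints ≠ 1 ∧ Nat.Prime 7 ∧ σ.onPoints ^ 7 = 1 ∧
      ProjectivePlane.order FanoPoint FanoLine = 2 :=
  ⟨fanoShift, fanoShift_onPoints_ne_one, by norm_num, fanoShift_onPoints_pow_seven, fano_order⟩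

end Summit.Ventures.DiscreteObjects.Runbook
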